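import Summits.CriticalPhenomena.SAWScalingLimit.Theses.SAWWeldingIdentification
import Summits.CriticalPhenomena.SAWScalingLimit.Theses.SAWLoopFugacityFlow
import Summits.CriticalPhenomena.SAWScalingLimit.Theorems.SAWWeldingIdentificationWeldingSetup
import Summits.CriticalPhenomena.SAWScalingLimit.Theorems.SAWWeldingIdentificationSLERemovableChord
import Summits.CriticalPhenomena.SAWScalingLimit.Theorems.SAWWeldingIdentificationWeldingLawOfLimitMarginals
import Summits.CriticalPhenomena.SAWScalingLimit.Theorems.SAWWeldingIdentificationWeldingLawOfLimitChordProxies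
import Summits.CriticalPhenomena.SAWScalingLimit.Theorems.SAWWeldingIdentificationWeldingLawOfLimitNecessity
import Literature.Probability.RandomPlanarGeometry.ConformalWelding

/-!
# Skeleton for crux `WeldingLawOfLimit` (stmt-CriticalPhenomena-4502), route `SAWWeldingIdentification`
# — line `registered` (birth skeleton `Lines/birth.lean`), reshaped by lead c1, v3 by lead c3, v4 by lead c10,
# v4.1 (soundness certificate) by lead c11 (2026-08-17)

The crux, BY NAME:
`Summit.CriticalPhenomena.SAWScalingLimit.Theses.SAWWeldingIdentification.WeldingLawOfLimit` — for
every conformal rectangle `Q`, endpoint approximation `(a, b)` of `Q.chord 0 2 = (Ω; a, b)`,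
probability measure `P` that is a weak limit of the pushed-forward critical `ℤ²` SAW laws along some
`δₙ → 0⁺`, EVERY welding functional `W` pinned on simple chords by the normalised uniformisers
(and Borel in the chord), every chordal SLE_{8/3} random curve `Γ` in `(Ω; a, b)`: all
finite-dimensional laws of `(W Q γ x₁, …, W Q γ x_k)`, `xᵢ > 0`, under `P` equal those under the
law of `Γ`.

## Where the crux sits (kernel-checked, in tree)

* (W) ⟺ ChordSupport ∧ CanonicalWeldingLaw (lead c1, p143706:
  `WeldingLawOfLimit.ae_isSimpleChord_of_weldingLawOfLimit`,
  `map_conformalWelding_eq_of_weldingLawOfLimit`, `weldingLawOfLimit_of_chordSupport_of_canonical`);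
* (W) ⟺ `SubseqIdentification` (stmt-CriticalPhenomena-0783, the shared identification crux of the
  sub-problem), UNCONDITIONALLY (lead c2 of stmt-4503:
  `RemovableLimit.weldingLawOfLimit_iff_subseqIdentification`, one-sided welding rigidity +
  identification by disintegration); (W) ⇒ stmt-4982 (`simpleSubseqLimits_of_weldingLawOfLimit`);
  (W) ∧ `EventualTight` ⇒ `SAWScalingLimit` (`sawScalingLimit_of_weldingLawOfLimit_of_eventualTight`).

## The cut, v3 (three named stubs; the composition `WeldingLawOfLimit_of` is sorry-free)

* `stub_simpleSubseqLimits` (= item stmt-CriticalPhenomena-4982 `SimpleSubseqLimits` BY NAME; open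
  problem, delegated to that item's own crux campaign): every subsequential weak limit of the
  critical SAW laws in a Dobrushin domain is carried by simple chords.
* `stub_approxWeldingLaw` (`ApproxWeldingLaw`; v3's held stub — DERIVED in v4 from `stub_latticeWeldingLaw`, see below):
  for every CHORD-SUPPORTED subsequential limit `P` (binders of the crux) there are chord-supported
  probability measures `Pₙ → P` (weakly) whose canonical-welding marginals at positive points
  converge weakly to those of chordal SLE_{8/3}. Intended witnesses: the laws of the chord-completed
  lattice walks at mesh `δₙ` (or any lattice-measurable chord proxies of them), i.e. "the LATTICE
  welding laws converge to the SLE_{8/3} welding law" — the level at which the route's engine (bank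
  independence → Sheffield's quantum zipper, Sheffield 2016 Thm 1.3, Duplantier–Miller–Sheffield
  2021 Thm 1.2, KMS welding uniqueness) would deliver it. With the constant witnesses `Pₙ := P` it
  is exactly v2's `CanonicalWeldingLaw` (`approxWeldingLaw_of_canonicalWeldingLaw` below), and the
  converse is stub 2b; so NO strength is added or hidden by the reshape.
* `stub_weldingMarginalsOfLimit` (`WeldingMarginalsOfLimit`, glue) — CLOSED in cycle c3 (worker, p150311,
  `Theorems/SAWWeldingIdentificationWeldingLawOfLimitMarginals.lean`): along
  chord-supported probability measures `Pₙ → P` converging weakly to a chord-supported `P`, the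
  finite-dimensional laws of `conformalWelding Q γ` converge weakly — the continuous-mapping
  theorem on the Borel set of simple chords, where `γ ↦ conformalWelding Q γ x` is continuous
  (tree: `continuousOn_conformalWelding`, Pommerenke Thm 2.11 / Radó; Mathlib portmanteau
  `ProbabilityMeasure.limsup_measure_closed_le_of_tendsto`, `tendsto_of_forall_isClosed_limsup_le'`).

Composition: `canonicalWeldingLaw_of : ApproxWeldingLaw → WeldingMarginalsOfLimit →
CanonicalWeldingLaw` (two weak limits of the same sequence of image laws on `ℝᵏ` coincide:
`tendsto_nhds_unique` on integrals of bounded continuous functions, `integral_map`,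
`ext_of_forall_integral_eq_of_IsFiniteMeasure`), then v2's composition: a pinned functional `W`
agrees with `conformalWelding` on simple chords (`eq_conformalWelding_of_pinned`), `P`-a.s. chords
by stub 1 at `D := Q.chord 0 2`, `ℙ ∘ Γ⁻¹`-a.s. chords by the proved support `SLERemovableChord_proof`
(`ae_isSimpleChord_map_sle`), `Measure.map_congr`, and `CanonicalWeldingLaw` applies.

## The cut, v4 (lead c10): the held stub moves to the LATTICE

* `stub_latticeWeldingLaw` (`LatticeWeldingLaw`, held by the lead; research-open — the route's bet in
  the form a lattice argument would prove it, NO subsequential limit `P` in it): for every `Q`,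
  endpoint approximation and `δₙ → 0⁺` there are CHORD PROXIES `cₙ ω` of the walk at mesh `δₙ`
  (functions of the walk, eventually a.s. simple chords of `(Ω; a, b)`, close to the walk in
  probability) whose canonical-welding marginals `∫ g (conformalWelding Q (cₙ ω) xᵢ)ᵢ dP_δₙ`
  converge to SLE_{8/3}'s — "the lattice welding laws converge to the SLE_{8/3} welding law".
* `stub_approxWeldingLaw` is now DERIVED: `ApproxWeldingLaw` follows from `LatticeWeldingLaw` by
  converging together (tree: `WeldingLawOfLimit.approxWeldingLaw_of_latticeWeldingLaw`, p161228);
  conversely, given the route's other cruxes stmt-4982 ∧ stmt-1372, `ApproxWeldingLaw ⟺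
  LatticeWeldingLaw` (`approxWeldingLaw_iff_latticeWeldingLaw`, p162152: chord proxies exist under
  tightness + simplicity by Prokhorov/portmanteau, `chordProxies_of_eventualTight_of_simpleSubseqLimits`;
  and `SAWScalingLimit ∧ proxies ⇒ LatticeWeldingLaw`, `latticeWeldingLaw_of_sawScalingLimit`,
  p161546). So relative to the ROUTE (which needs stmt-1372 anyway) the reshape adds no strength:
  modulo stmt-4982 ∧ stmt-1372, `SAWScalingLimit ⟺ LatticeWeldingLaw ⟺ ApproxWeldingLaw ⟺ (W) ⟺
  stmt-0783` (`sawScalingLimit_iff_latticeWeldingLaw_of_eventualTight`).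

## Soundness of the cut, v4.1 (lead c11): the stubs are consequences of the conjunct

Both registered stubs, and the route's tightness crux stmt-1372, follow from `SAWScalingLimit`
UNCONDITIONALLY (tree file `Theorems/SAWWeldingIdentificationWeldingLawOfLimitNecessity.lean`,
p164708: `simpleSubseqLimits_of_sawScalingLimit`, `latticeWeldingLaw_of_sawScalingLimit'`,
`eventualTight_of_sawScalingLimit`), and `SAWScalingLimit ⟺ stmt-4982 ∧ stmt-1372 ∧
LatticeWeldingLaw ⟺ (W) ∧ stmt-1372`
(`sawScalingLimit_iff_simpleSubseqLimits_and_eventualTight_and_latticeWeldingLaw`,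
`sawScalingLimit_iff_weldingLawOfLimit_and_eventualTight`). So a `stub-false` on either stub would
refute the Lawler–Schramm–Werner conjecture as typed (`not_sawScalingLimit_of_not_latticeWeldingLaw`):
the line bets on nothing beyond the conjunct, and its open content is the conformal-invariance
problem itself in welding form.

## Disproof / negatives used
No `Disproof.lean` exists for this crux (`ledger crux ls`, 2026-08-17T07:40Z: Lines/birth.*,
PICKED.md). `ledger negatives --problem CriticalPhenomena`: nothing on 4502 / 4503 / 4982 / 0783.
-/

noncomputable section

open MeasureTheory Filter Topology Set
open Literature.Probability.RandomPlanarGeometry Literature.Probability.LatticeModels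
open Literature.Probability.Process (preWienerMeasure)
open UpperHalfPlane (upperHalfPlaneSet)
open Summit.CriticalPhenomena.SAWScalingLimit.Theses
open Summit.CriticalPhenomena.SAWScalingLimit.Theorems

namespace Summit.CriticalPhenomena.SAWScalingLimit.Cruxes.WeldingLawOfLimit.Birth

/-! ### 1. Statements -/

/-- **The canonical welding law of chord-supported subsequential limits is the SLE_{8/3} welding
law** (v2's held stub, now DERIVED from stubs 2a, 2b by `canonicalWeldingLaw_of`). Same binders
as the crux, plus chord support of `P` as a hypothesis; conclusion for the ONE canonical functional
`conformalWelding` (all finite-dimensional marginals at positive points). -/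
def CanonicalWeldingLaw : Prop :=
  ∀ (Q : ConformalRectangle) (a b : ℝ → Site 2),
    SAW.IsEndpointApprox (Q.chord 0 2 (by decide)) a b →
    ∀ (P : Measure (CurveClass ℂ)), IsProbabilityMeasure P →
    ∀ (δs : ℕ → ℝ), (∀ n, 0 < δs n) → Tendsto δs atTop (𝓝 0) →
    (∀ f : BoundedContinuousFunction (CurveClass ℂ) ℝ,
      Tendsto (fun n => ∫ γ, f γ.curve ∂(SAW.law Q.carrier (δs n) (a (δs n)) (b (δs n))))
        atTop (𝓝 (∫ γ, f γ ∂P))) →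
    (∀ᵐ γ ∂P, (Q.chord 0 2 (by decide)).IsSimpleChord γ) →
    ∀ Γ : (NNReal → ℝ) → CurveClass ℂ, IsSLECurve ((8 : NNReal) / 3) (Q.chord 0 2 (by decide)) Γ →
    ∀ (k : ℕ) (x : Fin k → ℝ), (∀ i, 0 < x i) →
      P.map (fun γ i => conformalWelding Q γ (x i)) =
        (preWienerMeasure.map Γ).map (fun γ i => conformalWelding Q γ (x i))

/-- **Stub 2a — the welding law along chord-supported approximants.** For every chord-supported
subsequential weak limit `P` of the critical SAW laws in `(Q.chord 0 2; a_δ, b_δ)` (binders of the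
crux) there are chord-supported probability measures `Pₙ` on `CurveClass ℂ` converging weakly to
`P` whose canonical-welding marginals `(conformalWelding Q γ xᵢ)ᵢ`, `xᵢ > 0`, converge weakly to
those of chordal SLE_{8/3} in `(Ω; a, b)`. Intended witnesses: laws of chord-completed lattice
walks ("lattice welding laws converge to the SLE_{8/3} welding law", the bank-independence target);
with `Pₙ := P` it is `CanonicalWeldingLaw`. -/
def ApproxWeldingLaw : Prop :=
  ∀ (Q : ConformalRectangle) (a b : ℝ → Site 2),
    SAW.IsEndpointApprox (Q.chord 0 2 (by decide)) a b →
    ∀ (P : Measure (CurveClass ℂ)), IsProbabilityMeasure P →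
    ∀ (δs : ℕ → ℝ), (∀ n, 0 < δs n) → Tendsto δs atTop (𝓝 0) →
    (∀ f : BoundedContinuousFunction (CurveClass ℂ) ℝ,
      Tendsto (fun n => ∫ γ, f γ.curve ∂(SAW.law Q.carrier (δs n) (a (δs n)) (b (δs n))))
        atTop (𝓝 (∫ γ, f γ ∂P))) →
    (∀ᵐ γ ∂P, (Q.chord 0 2 (by decide)).IsSimpleChord γ) →
    ∃ Ps : ℕ → Measure (CurveClass ℂ),
      (∀ n, IsProbabilityMeasure (Ps n)) ∧
      (∀ n, ∀ᵐ γ ∂(Ps n), (Q.chord 0 2 (by decide)).IsSimpleChord γ) ∧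
      (∀ f : BoundedContinuousFunction (CurveClass ℂ) ℝ,
        Tendsto (fun n => ∫ γ, f γ ∂(Ps n)) atTop (𝓝 (∫ γ, f γ ∂P))) ∧
      ∀ Γ : (NNReal → ℝ) → CurveClass ℂ, IsSLECurve ((8 : NNReal) / 3) (Q.chord 0 2 (by decide)) Γ →
      ∀ (k : ℕ) (x : Fin k → ℝ), (∀ i, 0 < x i) →
      ∀ g : BoundedContinuousFunction (Fin k → ℝ) ℝ,
        Tendsto (fun n => ∫ γ, g (fun i => conformalWelding Q γ (x i)) ∂(Ps n)) atTop
          (𝓝 (∫ γ, g (fun i => conformalWelding Q γ (x i)) ∂(preWienerMeasure.map Γ)))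

/-- **Stub 2b — welding marginals pass to chord-supported weak limits.** If probability measures
`Pₙ → P` weakly on `CurveClass ℂ`, all carried by the simple chords of `(Ω; a, b) = Q.chord 0 2`,
then for every `k`, every `x : Fin k → ℝ` and every bounded continuous `g` on `ℝᵏ`,
`∫ g (conformalWelding Q γ xᵢ)ᵢ dPₙ → ∫ g (conformalWelding Q γ xᵢ)ᵢ dP` (continuous mapping on
the Borel set of simple chords, where the welding is continuous: `continuousOn_conformalWelding`). -/
def WeldingMarginalsOfLimit : Prop :=
  ∀ (Q : ConformalRectangle) (Ps : ℕ → Measure (CurveClass ℂ)) (P : Measure (CurveClass ℂ)),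
    (∀ n, IsProbabilityMeasure (Ps n)) → IsProbabilityMeasure P →
    (∀ n, ∀ᵐ γ ∂(Ps n), (Q.chord 0 2 (by decide)).IsSimpleChord γ) →
    (∀ᵐ γ ∂P, (Q.chord 0 2 (by decide)).IsSimpleChord γ) →
    (∀ f : BoundedContinuousFunction (CurveClass ℂ) ℝ,
      Tendsto (fun n => ∫ γ, f γ ∂(Ps n)) atTop (𝓝 (∫ γ, f γ ∂P))) →
    ∀ (k : ℕ) (x : Fin k → ℝ) (g : BoundedContinuousFunction (Fin k → ℝ) ℝ),
      Tendsto (fun n => ∫ γ, g (fun i => conformalWelding Q γ (x i)) ∂(Ps n)) atTop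
        (𝓝 (∫ γ, g (fun i => conformalWelding Q γ (x i)) ∂P))

/-- **Stub 2a, lattice form (v4) — the lattice welding laws converge to the SLE_{8/3} welding law.**
For every conformal rectangle `Q`, endpoint approximation `(a, b)` of `(Ω; a, b) = Q.chord 0 2` and
positive `δₙ → 0` there are chord proxies `cₙ ω ∈ CurveClass ℂ` of the critical SAW `ω` at mesh
`δₙ` — any functions of the walk (the SAW σ-algebra is discrete), eventually almost surely simple
chords of `(Ω; a, b)`, with `P_δₙ {ε < dist ω.curve (cₙ ω)} → 0` for every `ε > 0` — whose
canonical-welding marginals `∫ g (conformalWelding Q (cₙ ω) xᵢ)ᵢ dP_δₙ`, `xᵢ > 0`, converge to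
those of chordal SLE_{8/3} in `(Ω; a, b)`. Intended proxies: the chord completion of the walk
(deterministically close); intended engine: bank independence of the two-sided harmonic-measure
parametrisation + Sheffield's quantum zipper. -/
def LatticeWeldingLaw : Prop :=
  ∀ (Q : ConformalRectangle) (a b : ℝ → Site 2),
    SAW.IsEndpointApprox (Q.chord 0 2 (by decide)) a b →
    ∀ (δs : ℕ → ℝ), (∀ n, 0 < δs n) → Tendsto δs atTop (𝓝 0) →
    ∃ c : (n : ℕ) → SAW.DomainSAW Q.carrier (δs n) (a (δs n)) (b (δs n)) → CurveClass ℂ,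
      (∀ᶠ n in atTop, ∀ᵐ ω ∂(SAW.law Q.carrier (δs n) (a (δs n)) (b (δs n))),
        (Q.chord 0 2 (by decide)).IsSimpleChord (c n ω)) ∧
      (∀ ε : ℝ, 0 < ε →
        Tendsto (fun n => (SAW.law Q.carrier (δs n) (a (δs n)) (b (δs n))).real
          {ω | ε < dist ω.curve (c n ω)}) atTop (𝓝 0)) ∧
      ∀ Γ : (NNReal → ℝ) → CurveClass ℂ,
        IsSLECurve ((8 : NNReal) / 3) (Q.chord 0 2 (by decide)) Γ →
        ∀ (k : ℕ) (x : Fin k → ℝ), (∀ i, 0 < x i) →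
        ∀ g : BoundedContinuousFunction (Fin k → ℝ) ℝ,
          Tendsto (fun n => ∫ ω, g (fun i => conformalWelding Q (c n ω) (x i))
              ∂(SAW.law Q.carrier (δs n) (a (δs n)) (b (δs n)))) atTop
            (𝓝 (∫ γ, g (fun i => conformalWelding Q γ (x i)) ∂(preWienerMeasure.map Γ)))

/-! ### 2. The registered stubs -/

/-- STUB 1 = the shared crux item stmt-CriticalPhenomena-4982 `SimpleSubseqLimits` BY NAME (open
problem: simplicity + boundary avoidance of critical SAW subsequential limits; delegated to that
item's own crux campaign, not attacked here). -/
theorem stub_simpleSubseqLimits : SAWLoopFugacityFlow.SimpleSubseqLimits := by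
  sorry

/-- STUB 2a, LATTICE FORM (v4; open problem, the route's bet, held by the lead; engine: bank
independence / LQG zipper at `γ = √(8/3)`; implied by stmt-0783 ∧ stmt-4982 ∧ stmt-1372). -/
theorem stub_latticeWeldingLaw : LatticeWeldingLaw := by
  sorry

/-- Stub 2a in its v3 form — DERIVED in v4 (converging together, tree theorem
`WeldingLawOfLimit.approxWeldingLaw_of_latticeWeldingLaw`, p161228): no longer a registered stub;
equivalent to the lattice form given stmt-4982 ∧ stmt-1372 (`approxWeldingLaw_iff_latticeWeldingLaw`). -/
theorem stub_approxWeldingLaw : ApproxWeldingLaw :=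
  Summit.CriticalPhenomena.SAWScalingLimit.Theorems.WeldingLawOfLimit.approxWeldingLaw_of_latticeWeldingLaw
    stub_latticeWeldingLaw

/-- STUB 2b — CLOSED (cycle c3, worker wave 1, p150311): the tree theorem
`Theorems.WeldingLawOfLimit.weldingMarginalsOfLimit` (continuous mapping on the carrying Borel set
of simple chords, `tendsto_map_of_continuousOn_of_null` + `continuousOn_conformalWelding`). -/
theorem stub_weldingMarginalsOfLimit : WeldingMarginalsOfLimit :=
  Summit.CriticalPhenomena.SAWScalingLimit.Theorems.WeldingLawOfLimit.weldingMarginalsOfLimit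

namespace Registered

/-- Alias keyed by the registered stub name. -/
abbrev stub_simpleSubseqLimits : Prop := SAWLoopFugacityFlow.SimpleSubseqLimits
/-- Alias keyed by the registered stub name (v4). -/
abbrev stub_latticeWeldingLaw : Prop := LatticeWeldingLaw
/-- v3 stub, derived in v4 (kept as an alias for the record). -/
abbrev stub_approxWeldingLaw : Prop := ApproxWeldingLaw
/-- Alias keyed by the registered stub name. -/
abbrev stub_weldingMarginalsOfLimit : Prop := WeldingMarginalsOfLimit

end Registered

/-! ### 3. Sorry-free glue -/

/-- The welding vector `γ ↦ (conformalWelding Q γ xᵢ)ᵢ` is Borel. [folklore] -/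
theorem measurable_weldingVector (Q : ConformalRectangle) {k : ℕ} (x : Fin k → ℝ) :
    Measurable fun (γ : CurveClass ℂ) (i : Fin k) => conformalWelding Q γ (x i) :=
  measurable_pi_lambda _ fun i => measurable_conformalWelding Q (x i)

/-- **Stubs 2a ∧ 2b ⇒ `CanonicalWeldingLaw`.** Along the approximants `Pₙ` of stub 2a the image
laws of the welding vector converge weakly both to the image law under `P` (stub 2b, `P` being
chord-supported) and to the image law under the SLE law; weak limits of one sequence of probability
measures on `ℝᵏ` coincide (integrals of bounded continuous functions determine a finite Borel
measure on a metric space). [folklore] -/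
theorem canonicalWeldingLaw_of (h2a : ApproxWeldingLaw) (h2b : WeldingMarginalsOfLimit) :
    CanonicalWeldingLaw := by
  intro Q a b hab P hP δs hpos hδ hlim hPch Γ hΓ k x hx
  obtain ⟨Ps, hPsprob, hPsch, hPslim, hPsweld⟩ := h2a Q a b hab P hP δs hpos hδ hlim hPch
  have hVm := measurable_weldingVector Q x
  haveI : IsProbabilityMeasure preWienerMeasure :=
    Literature.Probability.RandomPlanarGeometry.isProbabilityMeasure_preWienerMeasure'
  haveI : IsProbabilityMeasure (preWienerMeasure.map Γ) := Measure.isProbabilityMeasure_map hΓ.1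
  refine ext_of_forall_integral_eq_of_IsFiniteMeasure fun g => ?_
  rw [integral_map hVm.aemeasurable g.continuous.aestronglyMeasurable,
    integral_map hVm.aemeasurable g.continuous.aestronglyMeasurable]
  exact tendsto_nhds_unique (h2b Q Ps P hPsprob hP hPsch hPch hPslim k x g) (hPsweld Γ hΓ k x hx g)

/-- **`CanonicalWeldingLaw ⇒ ApproxWeldingLaw`** (constant approximants `Pₙ := P`): stub 2a is not
stronger than v2's stub 2. [folklore] -/
theorem approxWeldingLaw_of_canonicalWeldingLaw (h : CanonicalWeldingLaw) : ApproxWeldingLaw := by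
  intro Q a b hab P hP δs hpos hδ hlim hPch
  refine ⟨fun _ => P, fun _ => hP, fun _ => hPch, fun f => tendsto_const_nhds, ?_⟩
  intro Γ hΓ k x hx g
  have hVm := measurable_weldingVector Q x
  have hmap := h Q a b hab P hP δs hpos hδ hlim hPch Γ hΓ k x hx
  have e1 := integral_map (μ := P) hVm.aemeasurable g.continuous.aestronglyMeasurable
  have e2 := integral_map (μ := preWienerMeasure.map Γ) hVm.aemeasurable
    g.continuous.aestronglyMeasurable
  rw [hmap] at e1
  have heq : ∫ γ, g (fun i => conformalWelding Q γ (x i)) ∂P =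
      ∫ γ, g (fun i => conformalWelding Q γ (x i)) ∂(preWienerMeasure.map Γ) := e1.symm.trans e2
  have hfun : (fun n : ℕ => ∫ γ, g (fun i => conformalWelding Q γ (x i)) ∂((fun _ : ℕ => P) n)) =
      fun _ => ∫ γ, g (fun i => conformalWelding Q γ (x i)) ∂(preWienerMeasure.map Γ) :=
    funext fun _ => heq
  rw [hfun]
  exact tendsto_const_nhds

/-- **Stub 1 at `D := Q.chord 0 2`**: chord support of every subsequential weak limit of the
critical SAW laws in `(Q.chord 0 2; a_δ, b_δ)` in the binders of the crux (a positive sequence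
tending to `0` tends to `0` within `(0, ∞)`); this is the landed
`ae_isSimpleChord_of_simpleSubseqLimits`, re-derived to keep the skeleton self-contained. [folklore] -/
theorem chordSupport_of_simpleSubseqLimits (h : SAWLoopFugacityFlow.SimpleSubseqLimits)
    (Q : ConformalRectangle) (a b : ℝ → Site 2)
    (hab : SAW.IsEndpointApprox (Q.chord 0 2 (by decide)) a b)
    (P : Measure (CurveClass ℂ)) (hP : IsProbabilityMeasure P)
    (δs : ℕ → ℝ) (hpos : ∀ n, 0 < δs n) (hδ : Tendsto δs atTop (𝓝 0))
    (hlim : ∀ f : BoundedContinuousFunction (CurveClass ℂ) ℝ,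
      Tendsto (fun n => ∫ γ, f γ.curve ∂(SAW.law Q.carrier (δs n) (a (δs n)) (b (δs n))))
        atTop (𝓝 (∫ γ, f γ ∂P))) :
    ∀ᵐ γ ∂P, (Q.chord 0 2 (by decide)).IsSimpleChord γ :=
  h (Q.chord 0 2 (by decide)) a b hab δs P
    (tendsto_nhdsWithin_iff.2 ⟨hδ, Eventually.of_forall fun n => mem_Ioi.2 (hpos n)⟩) hP hlim

/-- **Uniqueness of the welding.** Any functional `W` pinned on simple chords by the normalised
uniformisers (the hypothesis of the crux, verbatim) coincides with the Literature welding
`conformalWelding` at every simple chord and every `x > 0`: a configuration exists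
(`WeldingSetup_proof` (i)) and positive solutions of its welding equation are unique
(`conformalWelding_eq_of_isWeld`). [folklore] -/
theorem eq_conformalWelding_of_pinned
    (W : ConformalRectangle → CurveClass ℂ → ℝ → ℝ)
    (hWpin : ∀ (Q : ConformalRectangle) (γ : CurveClass ℂ) (s : ℝ) (L R : Set ℂ)
      (φ : ConformalEquiv upperHalfPlaneSet L) (ψ : ConformalEquiv upperHalfPlaneSet R),
      (γ ∈ CurveClass.simple ∧ γ.source = Q.pt 0 ∧ γ.target = Q.pt 2 ∧
        γ.range ⊆ closure Q.carrier ∧ γ.range ∩ frontier Q.carrier ⊆ {Q.pt 0, Q.pt 2}) →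
      (s = 1 ∨ s = -1) →
      (L ∪ R = Q.carrier \ γ.range ∧ Disjoint L R ∧ IsOpen L ∧ IsOpen R ∧ IsConnected L ∧
        IsConnected R ∧ Q.pt 1 ∈ closure L ∧ Q.pt 3 ∈ closure R) →
      (φ.HasBoundaryValue 0 (Q.pt 0) ∧ φ.HasBoundaryValueAtInfty (Q.pt 2) ∧
        φ.HasBoundaryValue ((s : ℝ) : ℂ) (Q.pt 1) ∧ ψ.HasBoundaryValue 0 (Q.pt 0) ∧
        ψ.HasBoundaryValueAtInfty (Q.pt 2) ∧ ψ.HasBoundaryValue (-((s : ℝ) : ℂ)) (Q.pt 3)) →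
      ∀ x : ℝ, 0 < x → 0 < W Q γ x ∧
        ψ.boundaryExtension (((s * x : ℝ)) : ℂ) =
          φ.boundaryExtension (((-(s * W Q γ x) : ℝ)) : ℂ))
    (Q : ConformalRectangle) {γ : CurveClass ℂ} (hγ : (Q.chord 0 2 (by decide)).IsSimpleChord γ)
    {x : ℝ} (hx : 0 < x) : W Q γ x = conformalWelding Q γ x := by
  obtain ⟨hsign, -⟩ := WeldingSetup_proof
  obtain ⟨s, hs, hconf⟩ := hsign Q
  obtain ⟨L, R, φ, ψ, hb, hn⟩ := hconf γ hγ
  obtain ⟨-, hw⟩ := hWpin Q γ s L R φ ψ hγ hs hb hn x hx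
  exact (conformalWelding_eq_of_isWeld hγ ⟨s, L, R, φ, ψ, hs, hb, hn⟩ hx hw).symm

/-- Chordal SLE_{8/3} is carried by simple chords: the law `ℙ ∘ Γ⁻¹` gives full mass to the simple
chords of `(Ω; a, b)` (PROVED support item `SLERemovableChord`, Rohde–Schramm 2005 Thm 6.1,
transported to the image measure through the Borel set of simple chords). [folklore] -/
theorem ae_isSimpleChord_map_sle (Q : ConformalRectangle) {Γ : (NNReal → ℝ) → CurveClass ℂ}
    (hΓ : IsSLECurve ((8 : NNReal) / 3) (Q.chord 0 2 (by decide)) Γ) :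
    ∀ᵐ γ ∂(preWienerMeasure.map Γ), (Q.chord 0 2 (by decide)).IsSimpleChord γ :=
  (ae_map_iff hΓ.1 (measurableSet_isSimpleChord Q)).2
    ((SLERemovableChord_proof Q Γ hΓ).mono fun _ hω => hω.1)

/-! ### 4. The composition: the three stubs imply the crux BY NAME -/

/-- **Skeleton theorem (v4).** `SimpleSubseqLimits → LatticeWeldingLaw → WeldingLawOfLimit`: the
lattice form gives stub 2a (`approxWeldingLaw_of_latticeWeldingLaw`); stub 2b
`WeldingMarginalsOfLimit` being proved, stubs 2a, 2b give `CanonicalWeldingLaw`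
(`canonicalWeldingLaw_of`); replace the
arbitrary pinned functional `W` by `conformalWelding` almost surely on both sides
(`eq_conformalWelding_of_pinned` on the full-measure sets of chords given by stub 1 at
`D := Q.chord 0 2` and by `ae_isSimpleChord_map_sle`, then `Measure.map_congr`), and apply it. -/
theorem WeldingLawOfLimit_of (h1 : Registered.stub_simpleSubseqLimits)
    (h2L : Registered.stub_latticeWeldingLaw) :
    Summit.CriticalPhenomena.SAWScalingLimit.Theses.SAWWeldingIdentification.WeldingLawOfLimit := by
  -- v4: the lattice form gives stub 2a by converging together (tree theorem, p161228)
  have h2a : ApproxWeldingLaw :=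
    Summit.CriticalPhenomena.SAWScalingLimit.Theorems.WeldingLawOfLimit.approxWeldingLaw_of_latticeWeldingLaw
      h2L
  -- stub 2b is CLOSED (tree theorem, p150311): it is used, no longer assumed
  have h2 : CanonicalWeldingLaw := canonicalWeldingLaw_of h2a stub_weldingMarginalsOfLimit
  intro _hmap W hWpin _hWmeas Q a b hab P hP δs hpos hδ hlim Γ hΓ k x hx
  -- chord support of the subsequential limit (stub 1 at `D := Q.chord 0 2`) and of the SLE law (proved)
  have hPch : ∀ᵐ γ ∂P, (Q.chord 0 2 (by decide)).IsSimpleChord γ :=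
    chordSupport_of_simpleSubseqLimits h1 Q a b hab P hP δs hpos hδ hlim
  have hμch : ∀ᵐ γ ∂(preWienerMeasure.map Γ), (Q.chord 0 2 (by decide)).IsSimpleChord γ :=
    ae_isSimpleChord_map_sle Q hΓ
  -- the pinned functional is the canonical welding almost surely, on both sides
  have hWP : (fun γ (i : Fin k) => W Q γ (x i)) =ᵐ[P] fun γ i => conformalWelding Q γ (x i) :=
    hPch.mono fun γ hγ => funext fun i => eq_conformalWelding_of_pinned W hWpin Q hγ (hx i)
  have hWμ : (fun γ (i : Fin k) => W Q γ (x i)) =ᵐ[preWienerMeasure.map Γ]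
      fun γ i => conformalWelding Q γ (x i) :=
    hμch.mono fun γ hγ => funext fun i => eq_conformalWelding_of_pinned W hWpin Q hγ (hx i)
  rw [Measure.map_congr hWP, Measure.map_congr hWμ]
  -- the canonical welding laws agree (stubs 2a ∧ 2b)
  exact h2 Q a b hab P hP δs hpos hδ hlim hPch Γ hΓ k x hx

/-- Wiring check: the registered stubs feed `WeldingLawOfLimit_of` as stated. -/
example : Summit.CriticalPhenomena.SAWScalingLimit.Theses.SAWWeldingIdentification.WeldingLawOfLimit :=
  WeldingLawOfLimit_of stub_simpleSubseqLimits stub_latticeWeldingLaw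

/-- Sanity (v4): relative to the route the reshape adds no strength — given stub 1 and the route's
tightness crux stmt-1372, the lattice stub is EQUIVALENT to the v3 stub `ApproxWeldingLaw`
(tree theorem `approxWeldingLaw_iff_latticeWeldingLaw`, p162152). -/
example (h1 : SAWLoopFugacityFlow.SimpleSubseqLimits) (hT : SAWWeldingIdentification.EventualTight) :
    ApproxWeldingLaw ↔ LatticeWeldingLaw :=
  Summit.CriticalPhenomena.SAWScalingLimit.Theorems.WeldingLawOfLimit.approxWeldingLaw_iff_latticeWeldingLaw
    h1 hT

/-- Soundness (v4.1, lead c11): both registered stubs follow from the conjunct `SAWScalingLimit`,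
unconditionally (tree theorem `registeredStubs_of_sawScalingLimit`, p164708) — the cut is not an
over-strong bet. -/
example (hS : _root_.SAWScalingLimit) :
    Registered.stub_simpleSubseqLimits ∧ Registered.stub_latticeWeldingLaw :=
  Summit.CriticalPhenomena.SAWScalingLimit.Theorems.WeldingLawOfLimit.registeredStubs_of_sawScalingLimit hS

/-- Exactness (v4.1, lead c11): the conjunct is equivalent to the two registered stubs together with
the route's tightness crux stmt-1372, unconditionally (tree theorem
`sawScalingLimit_iff_simpleSubseqLimits_and_eventualTight_and_latticeWeldingLaw`, p164708). -/
example : _root_.SAWScalingLimit ↔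
    (Registered.stub_simpleSubseqLimits ∧ SAWWeldingIdentification.EventualTight ∧
      Registered.stub_latticeWeldingLaw) :=
  Summit.CriticalPhenomena.SAWScalingLimit.Theorems.WeldingLawOfLimit.sawScalingLimit_iff_simpleSubseqLimits_and_eventualTight_and_latticeWeldingLaw

end Summit.CriticalPhenomena.SAWScalingLimit.Cruxes.WeldingLawOfLimit.Birth

end
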